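import Mathlib.Tactic.DeriveFintype
import Literature.Computability.Complexity.TruncMapMachine
import Literature.Computability.Complexity.SymbolPrograms
import Literature.Computability.Complexity.BoolEncodings
import Literature.Computability.Complexity.TM2PassThrough
import HarnessLib

/-!
# Unary clocks `x ↦ ⟨x, 1^{g|x|}⟩` for time-constructible `g`

Literature / complexity toolkit, the clock of the nondeterministic time hierarchy theorem
(`NTIMEHierarchyDiagonal.lean`, named fact `unaryClock_of_timeConstructible`): for a
time-constructible `g` (`g n ≥ n`, `1ⁿ ↦ bin (g n)` in time `O(g n)`, `IsTimeConstructible`) some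
`TM2` machine maps every word `x` to the pair word `⟨x, 1^{g |x|}⟩` within `a · g|x| + a` steps
(**`exists_unaryClock_of_timeConstructible`**). The machine is the pipeline

* `UnaryClock.pre`: `x ↦ ⟨1^{|x|}, x⟩` (a structured stack program, `11 |x| + 6` steps);
* `mapFstAux M_g` (`MapFstMachine.lean`): the constructor of `g` on the first component,
  `⟨1ⁿ, x⟩ ↦ ⟨bin (g n), x⟩`, `O(g n + n)` steps;
* `UnaryClock.post`: `⟨bin G, x⟩ ↦ ⟨x, 1^G⟩` — parse the pair word, convert the binary numeral
  (least significant digit first, Mathlib's `encodeNat`; read through the total decoder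
  `bitsToNat`) to unary by doubling from the most significant digit (`Σⱼ G/2ʲ ≤ 2G` steps), and
  write the swapped pair — a structured stack program, `33 G + 7 |x| + 22` steps;

composed by `Turing.TM2ComputableAux.comp` (additive time, `TimeBoundsProofs.lean`). This is
the equivalence of the binary-output and unary-output forms of time-constructibility for
`g n ≥ n` (Arora–Barak 2009, §1.3), in the pair form consumed by the truncating wrapper
`truncMapAux` (`TruncMapMachine.lean`).

## References

* S. Arora, B. Barak, *Computational Complexity: A Modern Approach*, CUP 2009, §1.3
  (time-constructible functions; robustness of the definitions).
* T. Nipkow, G. Klein, *Concrete Semantics with Isabelle/HOL*, Springer 2014, Ch. 7 (big-step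
  reasoning about structured programs; `SymbolPrograms.lean`).
-/

namespace Literature.Computability.Complexity

open _root_.Computability Turing

namespace UnaryClock

open ACom

/-- Registers of the clock programs: input, reversed payload, binary digits (most significant
on top), unary accumulator, scratch, output. [folklore] -/
inductive Rg
  | inp | xr | br | u | t | out
  deriving DecidableEq, Fintype

/-- Stores of the clock programs. [folklore] -/
abbrev Store : Type := AStore Bool Rg

/-- Programs over the registers `Rg` and the alphabet `Bool`. [folklore] -/
abbrev Prog : Type := ACom Bool Rg

/-- The store with prescribed register contents. [folklore] -/
def mk (inp xr br u t out : List Bool) : Store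
  | .inp => inp
  | .xr => xr
  | .br => br
  | .u => u
  | .t => t
  | .out => out

section MkLemmas

variable (i xr br u t o v : List Bool)

/-- Read-out of `inp`. [folklore] -/
@[simp] theorem mk_inp : mk i xr br u t o .inp = i := rfl
/-- Read-out of `xr`. [folklore] -/
@[simp] theorem mk_xr : mk i xr br u t o .xr = xr := rfl
/-- Read-out of `br`. [folklore] -/
@[simp] theorem mk_br : mk i xr br u t o .br = br := rfl
/-- Read-out of `u`. [folklore] -/
@[simp] theorem mk_u : mk i xr br u t o .u = u := rfl
/-- Read-out of `t`. [folklore] -/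
@[simp] theorem mk_t : mk i xr br u t o .t = t := rfl
/-- Read-out of `out`. [folklore] -/
@[simp] theorem mk_out : mk i xr br u t o .out = o := rfl

/-- Update of `inp`. [folklore] -/
@[simp] theorem update_mk_inp :
    Function.update (mk i xr br u t o) .inp v = mk v xr br u t o := by
  funext r; cases r <;> rfl
/-- Update of `xr`. [folklore] -/
@[simp] theorem update_mk_xr :
    Function.update (mk i xr br u t o) .xr v = mk i v br u t o := by
  funext r; cases r <;> rfl
/-- Update of `br`. [folklore] -/
@[simp] theorem update_mk_br :
    Function.update (mk i xr br u t o) .br v = mk i xr v u t o := by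
  funext r; cases r <;> rfl
/-- Update of `u`. [folklore] -/
@[simp] theorem update_mk_u :
    Function.update (mk i xr br u t o) .u v = mk i xr br v t o := by
  funext r; cases r <;> rfl
/-- Update of `t`. [folklore] -/
@[simp] theorem update_mk_t :
    Function.update (mk i xr br u t o) .t v = mk i xr br u v o := by
  funext r; cases r <;> rfl
/-- Update of `out`. [folklore] -/
@[simp] theorem update_mk_out :
    Function.update (mk i xr br u t o) .out v = mk i xr br u t v := by
  funext r; cases r <;> rfl

end MkLemmas

/-- The initial store. [folklore] -/
theorem single_inp (x : List Bool) : AStore.single .inp x = mk x [] [] [] [] [] := by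
  funext r; cases r <;> rfl

/-- The final store. [folklore] -/
theorem single_out (w : List Bool) : AStore.single .out w = mk [] [] [] [] [] w := by
  funext r; cases r <;> rfl

/-- Unary words. [folklore] -/
abbrev un (n : ℕ) : List Bool := List.replicate n true

/-- Doubling a unary word symbol by symbol gives the unary word of double length. [folklore] -/
theorem flatMap_dbl_un (n : ℕ) : ((un n).flatMap fun b => [b, b]) = un (2 * n) := by
  induction n with
  | zero => rfl
  | succ n ih =>
    simp only [un, List.replicate_succ, List.flatMap_cons] at ih ⊢
    rw [ih, show 2 * (n + 1) = 2 * n + 1 + 1 by ring, List.replicate_succ, List.replicate_succ]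
    rfl

/-- `boolPair 1ⁿ x = 1²ⁿ 0 1 x`. [folklore] -/
theorem boolPair_un (n : ℕ) (x : List Bool) : boolPair (un n) x = un (2 * n) ++ false :: true :: x := by
  simp [boolPair, flatMap_dbl_un]

/-- Mathlib's unary numeral is `1ⁿ`. [folklore] -/
theorem unaryEncodeNat_eq_un (n : ℕ) : unaryEncodeNat n = un n := by
  induction n with
  | zero => rfl
  | succ n ih => simp [unaryEncodeNat, ih, un, List.replicate_succ]

/-! ### `pre`: `x ↦ ⟨1^{|x|}, x⟩` -/

/-- `pre`: reverse the input onto `xr` counting its symbols on `u`; write it back to `out`;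
push the separator `0 1`; write two tokens per counted symbol. [folklore] -/
def pre : Prog :=
  (loop .inp fun b => push .xr b ;; push .u true) ;; pour .xr .out ;;
    push .out true ;; push .out false ;; loop .u fun _ => push .out true ;; push .out true

/-- Effect and cost of the counting stage of `pre`. [folklore] -/
theorem runs_pre_split (x : List Bool) :
    Runs (loop .inp fun b => push .xr b ;; push .u true) (mk x [] [] [] [] [])
      (mk [] x.reverse [] (un x.length) [] []) (4 * x.length + 1) := by
  have h := runs_loop_inv (k := Rg.inp) (f := fun b => push .xr b ;; push .u true)
    (fun done rest => mk rest done [] (un done.length) [] [])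
    (fun _ _ => True) 2
    (fun _ _ _ => rfl)
    (fun done a rest _ => ⟨trivial, by
      refine ((Runs.push' rfl).seq (Runs.push' ?_)).of_eq rfl (by norm_num)
      simp [un, List.replicate_succ]⟩)
    x [] trivial
  simpa using h

/-- Effect and cost of the token stage of `pre`: two tokens per unit. [folklore] -/
theorem runs_pre_tokens (o : List Bool) (n : ℕ) :
    Runs (loop .u fun _ => push .out true ;; push .out true) (mk [] [] [] (un n) [] o)
      (mk [] [] [] [] [] (un (2 * n) ++ o)) (4 * n + 1) := by
  have h := runs_loop_inv (k := Rg.u) (f := fun _ => push .out true ;; push .out true)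
    (fun done rest => mk [] [] [] rest [] (un (2 * done.length) ++ o))
    (fun _ _ => True) 2
    (fun _ _ _ => rfl)
    (fun done a rest _ => ⟨trivial, by
      refine ((Runs.push' rfl).seq (Runs.push' ?_)).of_eq rfl (by norm_num)
      simp only [update_mk_u, update_mk_out, mk_out, List.length_cons, un]
      rw [show 2 * (done.length + 1) = 2 * done.length + 1 + 1 by ring, List.replicate_succ,
        List.replicate_succ]
      rfl⟩)
    (un n) [] trivial
  simpa [un] using h

/-- **Effect and cost of `pre`**: `x ↦ ⟨1^{|x|}, x⟩` in `11 |x| + 5` steps. [folklore] -/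
theorem runs_pre (x : List Bool) :
    Runs pre (AStore.single .inp x) (AStore.single .out (boolPair (un x.length) x))
      (11 * x.length + 5) := by
  rw [single_inp, single_out, boolPair_un]
  unfold pre
  have h1 := runs_pre_split x
  have h2 := runs_pour (Γ := Bool) (a := Rg.xr) (b := Rg.out) (by decide)
    (mk [] x.reverse [] (un x.length) [] [])
  simp only [mk_xr, mk_out, List.reverse_reverse, List.append_nil, update_mk_xr, update_mk_out,
    List.length_reverse] at h2
  have h3 : Runs (push Rg.out true) (mk [] [] [] (un x.length) [] x)
      (mk [] [] [] (un x.length) [] (true :: x)) 1 := Runs.push' (by simp)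
  have h4 : Runs (push Rg.out false) (mk [] [] [] (un x.length) [] (true :: x))
      (mk [] [] [] (un x.length) [] (false :: true :: x)) 1 := Runs.push' (by simp)
  have h5 := runs_pre_tokens (false :: true :: x) x.length
  exact (h1.seq (h2.seq (h3.seq (h4.seq h5)))).of_eq rfl (by omega)

/-- **The machine of `pre`**: `x ↦ ⟨1^{|x|}, x⟩` within `11 |x| + 6` steps. [folklore] -/
theorem exists_machine_pre : ∃ M : TM2ComputableAux Bool Bool, ∀ x : List Bool,
    M.OutputsWithin x (boolPair (un x.length) x) (11 * x.length + 6) := by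
  obtain ⟨M, hM⟩ := ACom.exists_computesInTime pre .inp .out (id : List Bool → List Bool) id
    (fun x => boolPair (un x.length) x) (fun x => 11 * x.length + 5) runs_pre
  exact ⟨M, fun x => hM x⟩

/-! ### `post`: `⟨bin G, x⟩ ↦ ⟨x, 1^G⟩` -/

/-- The inner branch of `parse` after popping `b` and then `o`: an equal pair is a digit,
an unequal pair is the separator (send the rest to `xr`), a missing partner ends the input.
[folklore] -/
def parseInner (b : Bool) (o : Option Bool) : Prog :=
  match b, o with
  | true, some true => push .br true
  | false, some false => push .br false
  | _, some _ => pour .inp .xr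
  | _, none => skip

/-- The body of `parse`: pop the partner symbol and branch. [folklore] -/
def parseBody (b : Bool) : Prog := pop .inp (parseInner b)

/-- `parse`: read the pair word `⟨gs, x⟩` two symbols at a time: an equal pair `bb` is a binary
digit, pushed on `br`; the separator `01` sends the rest (`x`) reversed to `xr`. [folklore] -/
def parse : Prog := loop .inp parseBody

/-- Effect and cost of `parse` on a pair word: `5 |gs| + 3 |x| + 6` steps. [folklore] -/
theorem runs_parse (x : List Bool) : ∀ (gs br : List Bool),
    Runs parse (mk (boolPair gs x) [] br [] [] []) (mk [] x.reverse (gs.reverse ++ br) [] [] [])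
      (5 * gs.length + 3 * x.length + 6)
  | [], br => by
    have hin : boolPair [] x = false :: true :: x := rfl
    rw [hin]
    have hbody : Runs (parseInner false (some true)) (mk x [] br [] [] []) (mk [] x.reverse br [] [] [])
        (3 * x.length + 1) := by
      have := runs_pour (Γ := Bool) (a := Rg.inp) (b := Rg.xr) (by decide) (mk x [] br [] [] [])
      simpa [parseInner] using this
    have hpop : Runs (parseBody false) (mk (true :: x) [] br [] [] []) (mk [] x.reverse br [] [] [])
        (3 * x.length + 1 + 2) :=
      Runs.pop_cons' (f := parseInner false) (k := Rg.inp) (a := true) (w := x)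
        (R := mk (true :: x) [] br [] [] []) (R₀ := mk x [] br [] [] []) rfl (by simp) hbody
    have h := Runs.loop_cons' (f := parseBody) (k := Rg.inp) (a := false) (w := true :: x)
      (R := mk (false :: true :: x) [] br [] [] []) (R₀ := mk (true :: x) [] br [] [] []) rfl (by simp)
      hpop (Runs.loop_nil _ (R := mk [] x.reverse br [] [] []) rfl)
    refine h.of_eq ?_ (by omega)
    simp
  | b :: gs, br => by
    have hin : boolPair (b :: gs) x = b :: b :: boolPair gs x := rfl
    have ih := runs_parse x gs (b :: br)
    rw [hin]
    have hbody : Runs (parseInner b (some b)) (mk (boolPair gs x) [] br [] [] [])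
        (mk (boolPair gs x) [] (b :: br) [] [] []) 1 := by
      cases b <;> exact Runs.push' (by simp)
    have hpop := Runs.pop_cons' (f := parseInner b) (k := Rg.inp) (a := b) (w := boolPair gs x)
      (R := mk (b :: boolPair gs x) [] br [] [] []) (R₀ := mk (boolPair gs x) [] br [] [] [])
      rfl (by simp) hbody
    have h := Runs.loop_cons' (f := parseBody) (k := Rg.inp) (a := b) (w := b :: boolPair gs x)
      (R := mk (b :: b :: boolPair gs x) [] br [] [] []) (R₀ := mk (b :: boolPair gs x) [] br [] [] [])
      rfl (by simp) hpop ih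
    refine h.of_eq ?_ ?_
    · simp
    · simp only [List.length_cons]; omega

/-- `dblU`: double the unary accumulator `u` (through the scratch register `t`). [folklore] -/
def dblU : Prog := (loop .u fun _ => push .t true ;; push .t true) ;; pour .t .u

/-- Effect and cost of `dblU`: `10 m + 2` steps on `u = 1ᵐ`. [folklore] -/
theorem runs_dblU (xr br o : List Bool) (m : ℕ) :
    Runs dblU (mk [] xr br (un m) [] o) (mk [] xr br (un (2 * m)) [] o) (10 * m + 2) := by
  unfold dblU
  have h1 := runs_loop_inv (k := Rg.u) (f := fun _ => push .t true ;; push .t true)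
    (fun done rest => mk [] xr br rest (un (2 * done.length)) o)
    (fun _ _ => True) 2
    (fun _ _ _ => rfl)
    (fun done a rest _ => ⟨trivial, by
      refine ((Runs.push' rfl).seq (Runs.push' ?_)).of_eq rfl (by norm_num)
      simp only [update_mk_u, update_mk_t, mk_t, List.length_cons, un]
      rw [show 2 * (done.length + 1) = 2 * done.length + 1 + 1 by ring, List.replicate_succ,
        List.replicate_succ]⟩)
    (un m) [] trivial
  simp only [List.append_nil, List.length_reverse, List.length_replicate, un, List.length_nil,
    mul_zero, List.replicate_zero] at h1
  have h2 := runs_pour (Γ := Bool) (a := Rg.t) (b := Rg.u) (by decide)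
    (mk [] xr br [] (un (2 * m)) o)
  simp only [mk_t, mk_u, un, List.reverse_replicate, List.append_nil, update_mk_t, update_mk_u,
    List.length_replicate] at h2
  exact (h1.seq h2).of_eq rfl (by omega)

/-- `addBit b`: add the digit `b` to the unary accumulator. [folklore] -/
def addBit : Bool → Prog
  | true => push .u true
  | false => skip

/-- Effect and cost of `addBit`. [folklore] -/
theorem runs_addBit (xr br o : List Bool) (m : ℕ) (b : Bool) :
    Runs (addBit b) (mk [] xr br (un m) [] o) (mk [] xr br (un (b.toNat + m)) [] o) 1 := by
  cases b
  · exact (Runs.skip _).of_eq (by simp) (by norm_num)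
  · exact Runs.push' (by simp [un, List.replicate_succ, Nat.add_comm])

/-- `conv`: Horner conversion of the digits on `br` (most significant on top) into the unary
accumulator: double, then add the digit. [folklore] -/
def conv : Prog := loop .br fun b => dblU ;; addBit b

/-- Exact cost of `conv` on the digits `q` (most significant first) from accumulator value
`m`. [folklore] -/
def cConv : List Bool → ℕ → ℕ
  | [], _ => 1
  | b :: q, m => (10 * m + 2 + 1 + 2) + cConv q (b.toNat + 2 * m)

/-- The value accumulated by `conv` on the digits `q` (most significant first) from `m`:
Horner's rule; for `m = 0` this is `bitsToNat q.reverse`. [folklore] -/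
def horner : List Bool → ℕ → ℕ
  | [], m => m
  | b :: q, m => horner q (b.toNat + 2 * m)

/-- Horner's rule computes the binary value (digits reversed to least significant first).
[folklore] -/
theorem horner_eq (q : List Bool) : ∀ m : ℕ, horner q m = m * 2 ^ q.length + bitsToNat q.reverse := by
  induction q with
  | nil => intro m; simp [horner]
  | cons b q ih =>
    intro m
    rw [horner, ih, List.reverse_cons, bitsToNat_append, List.length_reverse, List.length_cons,
      pow_succ]
    simp
    ring

/-- The cost of `conv` is linear in the final value: `cConv q m + 20 m ≤ 20 · horner q m + 5 |q| + 1`.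
[folklore] -/
theorem cConv_le (q : List Bool) : ∀ m : ℕ, cConv q m + 20 * m ≤ 20 * horner q m + 5 * q.length + 1 := by
  induction q with
  | nil => intro m; simp [cConv, horner]; omega
  | cons b q ih =>
    intro m
    have h := ih (b.toNat + 2 * m)
    simp only [cConv, horner, List.length_cons]
    have hb : b.toNat ≤ 1 := Bool.toNat_le b
    omega

/-- Effect and exact cost of `conv`. [folklore] -/
theorem runs_conv (xr o : List Bool) : ∀ (q : List Bool) (m : ℕ),
    Runs conv (mk [] xr q (un m) [] o) (mk [] xr [] (un (horner q m)) [] o) (cConv q m)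
  | [], m => by
    have h := Runs.loop_nil (fun b => dblU ;; addBit b) (k := Rg.br) (R := mk [] xr [] (un m) [] o) rfl
    simpa [conv, cConv, horner] using h
  | b :: q, m => by
    have ih := runs_conv xr o q (b.toNat + 2 * m)
    unfold conv at ih ⊢
    have hbody : Runs (dblU ;; addBit b) (mk [] xr q (un m) [] o)
        (mk [] xr q (un (b.toNat + 2 * m)) [] o) (10 * m + 2 + 1) :=
      (runs_dblU xr q o m).seq (runs_addBit xr q o (2 * m) b)
    have h := Runs.loop_cons' (k := Rg.br) (a := b) (w := q) (R := mk [] xr (b :: q) (un m) [] o)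
      rfl (by simp) hbody ih
    exact h.of_eq rfl (by simp [cConv])

/-- `emit`: write `1^G`, the separator and the doubled payload to `out`. [folklore] -/
def emit : Prog :=
  pour .u .out ;; push .out true ;; push .out false ;; loop .xr fun b => push .out b ;; push .out b

/-- Effect and cost of the payload stage of `emit`: doubling the reversed payload back in order.
[folklore] -/
theorem runs_emit_payload (x o : List Bool) :
    Runs (loop .xr fun b => push .out b ;; push .out b) (mk [] x.reverse [] [] [] o)
      (mk [] [] [] [] [] ((x.flatMap fun b => [b, b]) ++ o)) (4 * x.length + 1) := by
  have h := runs_loop_inv (k := Rg.xr) (f := fun b => push .out b ;; push .out b)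
    (fun done rest => mk [] rest [] [] [] ((done.flatMap fun b => [b, b]) ++ o))
    (fun _ _ => True) 2
    (fun _ _ _ => rfl)
    (fun done a rest _ => ⟨trivial, by
      refine ((Runs.push' rfl).seq (Runs.push' ?_)).of_eq rfl (by norm_num)
      simp⟩)
    x.reverse [] trivial
  simpa using h

/-- Effect and cost of `emit`. [folklore] -/
theorem runs_emit (x : List Bool) (G : ℕ) :
    Runs emit (mk [] x.reverse [] (un G) [] []) (mk [] [] [] [] [] (boolPair x (un G)))
      (3 * G + 1 + 1 + 1 + (4 * x.length + 1)) := by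
  unfold emit
  have h1 := runs_pour (Γ := Bool) (a := Rg.u) (b := Rg.out) (by decide)
    (mk [] x.reverse [] (un G) [] [])
  simp only [mk_u, mk_out, un, List.reverse_replicate, List.append_nil, update_mk_u,
    update_mk_out, List.length_replicate] at h1
  have h2 : Runs (push Rg.out true) (mk [] x.reverse [] [] [] (un G))
      (mk [] x.reverse [] [] [] (true :: un G)) 1 := Runs.push' (by simp)
  have h3 : Runs (push Rg.out false) (mk [] x.reverse [] [] [] (true :: un G))
      (mk [] x.reverse [] [] [] (false :: true :: un G)) 1 := Runs.push' (by simp)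
  have h4 := runs_emit_payload x (false :: true :: un G)
  refine (h1.seq (h2.seq (h3.seq h4))).of_eq ?_ (by omega)
  simp [boolPair]

/-- `post`: parse, convert, emit. [folklore] -/
def post : Prog := parse ;; conv ;; emit

/-- **Effect and cost of `post`**: `⟨gs, x⟩ ↦ ⟨x, 1^{bitsToNat gs}⟩` within
`23 · bitsToNat gs + 10 |gs| + 7 |x| + 11` steps. [folklore] -/
theorem runs_post (gs x : List Bool) :
    Runs post (AStore.single .inp (boolPair gs x)) (AStore.single .out (boolPair x (un (bitsToNat gs))))
      (23 * bitsToNat gs + 10 * gs.length + 7 * x.length + 11) := by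
  rw [single_inp, single_out]
  unfold post
  have h1 := runs_parse x gs []
  simp only [List.append_nil] at h1
  have h2 := runs_conv x.reverse [] gs.reverse 0
  have hval : horner gs.reverse 0 = bitsToNat gs := by simp [horner_eq]
  rw [hval] at h2
  have h3 := runs_emit x (bitsToNat gs)
  have hc := cConv_le gs.reverse 0
  rw [hval, List.length_reverse] at hc
  exact (h1.seq (h2.seq h3)).of_eq rfl (by omega)

/-- **The machine of `post`**: `⟨bin G, x⟩ ↦ ⟨x, 1^G⟩` within `33 G + 7 |x| + 22` steps
(`|bin G| ≤ G + 1`). [folklore] -/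
theorem exists_machine_post : ∃ M : TM2ComputableAux Bool Bool, ∀ (G : ℕ) (x : List Bool),
    M.OutputsWithin (boolPair (encodeNat G) x) (boolPair x (un G)) (33 * G + 7 * x.length + 22) := by
  obtain ⟨M, hM⟩ := ACom.exists_computesInTime post .inp .out
    (fun p : List Bool × List Bool => boolPair p.1 p.2)
    (fun p : List Bool × List Bool => boolPair p.1 p.2)
    (fun p => (p.2, un (bitsToNat p.1)))
    (fun p => 23 * bitsToNat p.1 + 10 * p.1.length + 7 * p.2.length + 11)
    (fun p => runs_post p.1 p.2)
  refine ⟨M, fun G x => ?_⟩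
  have h := hM (encodeNat G, x)
  simp only [bitsToNat_encodeNat] at h
  refine h.mono ?_
  have hlen : (encodeNat G).length ≤ G + 1 := TM2Pass.length_encodeNat_le_self G
  omega

end UnaryClock

/-! ### The clock machine -/

open UnaryClock in
/-- **Every time-constructible function has a unary clock**: for `IsTimeConstructible g` some
`TM2` machine maps `x` to `⟨x, 1^{g |x|}⟩` within `a · g |x| + a` steps — the pipeline
`pre`, the constructor of `g` on the first component (`mapFstAux`), `post`, with additive
running times (`Turing.TM2ComputableAux.comp_outputsWithin`) and `|x| ≤ g |x|`.
[cite: AroraBarak2009, §1.3 (time-constructible functions)] -/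
theorem exists_unaryClock_of_timeConstructible {g : ℕ → ℕ} (hg : IsTimeConstructible g) :
    ∃ (N : TM2ComputableAux Bool Bool) (a : ℕ), ∀ x : List Bool,
      N.OutputsWithin x (boolPair x (List.replicate (g x.length) true)) (a * g x.length + a) := by
  obtain ⟨hge, c, Mg, hMg⟩ := hg
  obtain ⟨M₁, hM₁⟩ := exists_machine_pre
  obtain ⟨M₃, hM₃⟩ := exists_machine_post
  refine ⟨M₁.comp ((mapFstAux Mg).comp M₃), c + 103, fun x => ?_⟩
  obtain ⟨n, hn0⟩ : ∃ n, x.length = n := ⟨_, rfl⟩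
  rw [hn0]
  -- stage 2: the constructor on the first component
  have h2 : (mapFstAux Mg).OutputsWithin (boolPair (un n) x) (boolPair (encodeNat (g n)) x)
      ((c * g n + c) + 3 * (encodeNat (g n)).length + 2 * (boolPair (un n) x).length + 6) := by
    have hz : Mg.OutputsWithin (boolUnpair (boolPair (un n) x)).1 (encodeNat (g n)) (c * g n + c) := by
      have := hMg n
      dsimp only at this
      rw [unaryEncodeNat_eq_un] at this
      simpa [un] using this
    have := outputsWithin_mapFstAux Mg hz
    rwa [readRest_boolPair] at this
  have h23 := Turing.TM2ComputableAux.comp_outputsWithin _ _ h2 (hM₃ (g n) x)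
  have h1 := hM₁ x
  rw [hn0] at h1
  have h := Turing.TM2ComputableAux.comp_outputsWithin _ _ h1 h23
  refine h.mono ?_
  have hlen : (encodeNat (g n)).length ≤ g n + 1 := TM2Pass.length_encodeNat_le_self (g n)
  have hn : n ≤ g n := hge n
  have hp : (boolPair (un n) x).length = 2 * n + 2 + n := by simp [un, hn0]
  rw [hp, hn0]
  have e : (c + 103) * g n = c * g n + 103 * g n := by ring
  omega

end Literature.Computability.Complexity
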